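import Literature.Computability.AlgebraicComplexity.RazUniversalCircuits
import Literature.Computability.AlgebraicComplexity.RazTildeBlocks
import Literature.Computability.AlgebraicComplexity.RazElusiveGeneralRouteProofs
import Literature.Computability.AlgebraicComplexity.ValiantCompleteness
import HarnessLib

/-!
# Raz 2010, Corollary 3.9 (= Cor. 1.6): discharge of the named fact `Raz2010_cor_3_9`

R. Raz, *Elusive functions and lower bounds for arithmetic circuits*, Theory of Computing 6
(2010) 135–177, **Cor. 3.9** (p. 163; = Cor. 1.6, p. 145): over a field `F` of characteristic
`≠ 2`, for `1 ≤ r ≤ n ≤ s`, `m = n · C(n+r-1, r)`, `s = n^{ω(1)}`, a poly(`n`)-definable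
polynomial mapping `f : Fⁿ → F^m` that is `(s, 2r-1)`-elusive over some extension field
`G ⊇ F` forces super-polynomial arithmetic circuits for the permanent over `F`. The named fact
`Raz2010_cor_3_9` (`RazElusiveGeneral.lean`) renders the conclusion as
`¬ IsPComputable (fun N => perPoly (Fin N) F)`; this file proves it:
`Raz2010_cor_3_9_holds`.

## The printed proof (p. 163) and its rendering here

"By Proposition 3.6, and Corollary 3.8, the polynomial `f̃ : F^{3n} → F` … is
poly(`n`)-definable, and any arithmetic circuit (over `F`) for `f̃` is of size `≥ s^{Ω(1)}`.
Valiant proved that … the permanent is a complete polynomial for the class VNP of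
poly(`n`)-definable polynomials. Hence, any arithmetic circuit of size `s′` for the permanent
implies an arithmetic circuit of size poly(`s′`) for any other poly(`n`)-definable polynomial.
Hence, any arithmetic circuit for the permanent over `F` is of size `s′ ≥ s^{Ω(1)}`." Behind
Cor. 3.8 stand Prop. 3.7 (Baur–Strassen for the `n` partial derivatives `f̃ᵢ` of
`f̃ = ∑ᵢ wᵢ f̃ᵢ`; Prop. 3.5, `H(f̃|_a) = f(a)`; Prop. 3.3 = Props. 2.3, 2.8, 3.1, 3.2: the
universal circuit-graph in normal-homogeneous form and the degree `2r - 1` of its polynomial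
mapping `Γ_G`) and the remark that circuits over `F` are circuits over `G`.

The proof below follows this architecture with the tree's ingredients:

* Valiant's completeness of `PER` in characteristic `≠ 2` is the tree's theorem
  `isVNPComplete_perPoly_holds` (`ValiantCompleteness.lean`); p-computability of `PER` then
  makes every `VNP` family p-computable (`IsPComputable.of_isPProjection_holds`).
* The universal circuit and the degree bound `2r - 1` are `RazUniversalCircuits.lean`
  (`RazUniversal.exists_eval_uCoeff_eq_coeff`, `RazUniversal.totalDegree_uCoeff_le`,
  `RazUniversal.card_lab_le`).
* The poly(`n`)-definable polynomial carrying `f` in its coefficients is the binary-block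
  `f̃` of `RazTildeBlocks.lean` (`RazBlocks.tilde`; see that file for the comparison with
  Raz's lexicographic `f̃`): it is a `VNP` family by construction (`isPolyDefinable_T`), and
  after `x := a` it is a degree-`r` form whose `Z_idx`-coefficient is `f_idx(a)`
  (`RazBlocks.coeff_zexpZ_blockSumAt`, Prop. 3.5).
* Since only the super-polynomial conclusion is rendered, polynomial factors are free:
  instead of Baur–Strassen (one circuit for the `n` partials) each value `f̃|_a` is handled
  as a single homogeneous polynomial (the partials `f̃ᵢ` are replaced by the block structure
  of `f̃`), and the universal map is taken in all its `poly(n)` labels; elusiveness in `s(n)`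
  variables is weakened to the number of labels by `IsElusive.anti_left` once
  `s(n) ≥ n^{ω(1)}` exceeds it. The passage to the extension field `G` is
  `ArithCircuit.complexity_map_le` of `RazElusiveGeneralRouteProofs.lean` (a circuit over `F`
  is a circuit over `G`, cf. p. 162 and p. 172).

No statement of the paper is asserted here; `Raz2010_cor_3_9` itself is unchanged.

## References

* R. Raz, *Elusive functions and lower bounds for arithmetic circuits*, Theory of Computing 6
  (2010) 135–177: Cor. 3.9 (p. 163) = Cor. 1.6 (p. 145); Props. 3.5–3.7, Cor. 3.8
  (pp. 160–163); Props. 2.3, 2.8, 3.1–3.3 (pp. 149–158); Def. 1.1, Def. 1.3.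
* L. G. Valiant, *Completeness classes in algebra*, STOC 1979 (`VNP`-completeness of `PER`).
* P. Bürgisser, *Completeness and Reduction in Algebraic Complexity Theory*, Springer 2000,
  Thm. 2.10, Def. 2.1, §4.1 (extension of scalars).
-/

noncomputable section

open MvPolynomial

namespace Literature.Computability.AlgebraicComplexity

universe u v w

namespace RazCor39

/-! ### Parameters of the construction along Raz's basic parameter `n` -/

section Params

variable (r : ℕ → ℕ)

/-- The number of blocks `R = min(r, n)` (equal to Raz's degree `r` in the range `r ≤ n` of
Cor. 3.9; capped so that all bounds are polynomial in `n` at every index).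
[cite: Raz2010, Cor. 3.9 (p. 163)] -/
def RR (n : ℕ) : ℕ := min (r n) n

/-- The number of bits per block, `β = 2⌈log₂ 2n⌉`. [folklore] -/
def ββ (n : ℕ) : ℕ := 2 * Nat.clog 2 (2 * n)

/-- The number of index bits used by the blocks, `K = ⌈log₂ (n · C(n+R-1, R))⌉`.
[cite: Raz2010, Def. 1.3 (p. 142)] -/
def KK (n : ℕ) : ℕ := Nat.clog 2 (n * Nat.choose (n + RR r n - 1) (RR r n))

/-- The number of index variables of the Def. 1.3 witness, `⌈log₂ m⌉`, `m = n · C(n+r-1, r)`.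
[cite: Raz2010, Def. 1.3 (p. 142)] -/
def Kw (n : ℕ) : ℕ := Nat.clog 2 (n * Nat.choose (n + r n - 1) (r n))

/-- `R ≤ n`. [folklore] -/
theorem RR_le (n : ℕ) : RR r n ≤ n := min_le_right _ _

/-- In the range of Cor. 3.9, `R = r`. [cite: Raz2010, Cor. 3.9 (p. 163)] -/
theorem RR_eq {n : ℕ} (h : r n ≤ n) : RR r n = r n := min_eq_left h

/-- `2^β ≤ (4n + 1)²`. [folklore] -/
theorem two_pow_ββ_le (n : ℕ) : 2 ^ ββ n ≤ (4 * n + 1) ^ 2 := by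
  unfold ββ
  rw [mul_comm 2 (Nat.clog 2 (2 * n)), pow_mul]
  exact Nat.pow_le_pow_left ((RazBlocks.two_pow_clog_le (2 * n)).trans (by omega)) 2

/-- `K ≤ n β + n` at every index. [folklore] -/
theorem KK_le (n : ℕ) : KK r n ≤ n * ββ n + n := by
  unfold KK
  rcases Nat.eq_zero_or_pos (RR r n) with h0 | hpos
  · rw [h0, Nat.choose_zero_right, mul_one]
    exact (clog_two_le_self n).trans (Nat.le_add_left _ _)
  · calc Nat.clog 2 (n * Nat.choose (n + RR r n - 1) (RR r n))
        ≤ RR r n * (2 * Nat.clog 2 (2 * n)) := RazBlocks.clog_index_le hpos (RR_le r n)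
      _ ≤ n * ββ n := Nat.mul_le_mul_right _ (RR_le r n)
      _ ≤ n * ββ n + n := Nat.le_add_right _ _

/-- In the range of Cor. 3.9 the index bits fit into the blocks: `K ≤ R β`.
[cite: Raz2010, Cor. 3.9 (p. 163)] -/
theorem KK_le_mul {n : ℕ} (h1 : 1 ≤ r n) (h2 : r n ≤ n) : KK r n ≤ RR r n * ββ n := by
  unfold KK ββ
  exact RazBlocks.clog_index_le (by rw [RR_eq r h2]; exact h1) (RR_le r n)

/-- In the range of Cor. 3.9 every index is below `2^K`: `m = n · C(n+r-1, r) ≤ 2^K`.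
[cite: Raz2010, Def. 1.3 (p. 142)] -/
theorem m_le_two_pow_KK {n : ℕ} (h2 : r n ≤ n) :
    n * Nat.choose (n + r n - 1) (r n) ≤ 2 ^ KK r n := by
  unfold KK
  rw [RR_eq r h2]
  exact Nat.le_pow_clog one_lt_two _

/-- `R` is p-bounded. [folklore] -/
theorem isPBounded_RR : IsPBounded (RR r) :=
  IsPBounded.id.mono (RR_le r)

/-- `β` is p-bounded. [folklore] -/
theorem isPBounded_ββ : IsPBounded ββ :=
  (IsPBounded.mul_holds (IsPBounded.const 2) (IsPBounded.mul_holds (IsPBounded.const 2)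
    IsPBounded.id)).mono fun n => Nat.mul_le_mul_left 2 (clog_two_le_self (2 * n))

/-- `2^β` is p-bounded. [folklore] -/
theorem isPBounded_two_pow_ββ : IsPBounded fun n => 2 ^ ββ n :=
  (IsPBounded.pow_holds (IsPBounded.add_holds (IsPBounded.mul_holds (IsPBounded.const 4)
    IsPBounded.id) (IsPBounded.const 1)) 2).mono two_pow_ββ_le

/-- `K` is p-bounded. [folklore] -/
theorem isPBounded_KK : IsPBounded (KK r) :=
  (IsPBounded.add_holds (IsPBounded.mul_holds IsPBounded.id isPBounded_ββ) IsPBounded.id).mono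
    (KK_le r)

/-- The number of slots of the universal circuit-graph for circuits of size `sb n`:
`N = 4 sb (R+1)²`. [cite: Raz2010, Prop. 2.8 (p. 154)] -/
def NN (sb : ℕ → ℕ) (n : ℕ) : ℕ := 4 * sb n * (RR r n + 1) ^ 2

/-- `N` is p-bounded when `sb` is. [folklore] -/
theorem isPBounded_NN {sb : ℕ → ℕ} (hsb : IsPBounded sb) : IsPBounded (NN r sb) :=
  IsPBounded.mul_holds (IsPBounded.mul_holds (IsPBounded.const 4) hsb)
    (IsPBounded.pow_holds (IsPBounded.add_holds (isPBounded_RR r) (IsPBounded.const 1)) 2)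

/-- The `z`-variables of level `n`: `z_{(t, c)}`, `t < R`, `c < 2^β`. [cite: Raz2010, §3.3 (p. 159)] -/
abbrev σZ (n : ℕ) : Type := Fin (RR r n) × Fin (2 ^ ββ n)

/-- The number of labels of the universal circuit-graph over the `z`-variables is p-bounded.
[cite: Raz2010, Prop. 3.3 (p. 158)] -/
theorem isPBounded_card_lab {sb : ℕ → ℕ} (hsb : IsPBounded sb) :
    IsPBounded fun n => Fintype.card (RazUniversal.Lab (σZ r n) (RR r n) (NN r sb n)) := by
  have hσ : (fun n => Fintype.card (σZ r n)) = fun n => RR r n * 2 ^ ββ n := by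
    funext n
    simp [Fintype.card_prod, Fintype.card_fin]
  have hcard : IsPBounded fun n => Fintype.card (σZ r n) := by
    rw [hσ]
    exact IsPBounded.mul_holds (isPBounded_RR r) isPBounded_two_pow_ββ
  refine (IsPBounded.mul_holds (IsPBounded.const 3) (IsPBounded.pow_holds
    (IsPBounded.add_holds (IsPBounded.add_holds (IsPBounded.add_holds hcard (isPBounded_RR r))
      (isPBounded_NN r hsb)) (IsPBounded.const 1)) 5)).mono fun n => ?_
  exact RazUniversal.card_lab_le (σZ r n) (RR r n) (NN r sb n)

/-- A p-bounded function is eventually below a fixed power. [folklore] -/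
theorem eventually_le_pow {t : ℕ → ℕ} (ht : IsPBounded t) :
    ∃ C n₀ : ℕ, ∀ n ≥ n₀, t n ≤ n ^ C := by
  obtain ⟨c, hc⟩ := ht
  refine ⟨c + 1, c + 2, fun n hn => (hc n).trans ?_⟩
  have h2 : 2 ≤ n := by omega
  have hcn : c ≤ n ^ c :=
    ((Nat.lt_two_pow_self).le).trans (Nat.pow_le_pow_left h2 c)
  calc n ^ c + c ≤ n ^ c + n ^ c := Nat.add_le_add_left hcn _
    _ = 2 * n ^ c := by ring
    _ ≤ n * n ^ c := Nat.mul_le_mul_right _ h2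
    _ = n ^ (c + 1) := by ring

end Params

/-! ### The `VNP` family `f̃` and its complexity under `PER ∈ VP` -/

section Family

variable {F : Type u} [Field F] (r ℓ : ℕ → ℕ)
  (g : ∀ n, MvPolynomial ((Fin n ⊕ Fin (ℓ n)) ⊕ Fin (Kw r n)) F)

/-- The variables of `f̃ n`: `x₁, …, xₙ` and the `z_{(t, c)}`. [cite: Raz2010, §3.3 (p. 159)] -/
abbrev XZf (n : ℕ) : Type := RazBlocks.XZ n (RR r n) (ββ n)

/-- **The family `f̃`** built from the Def. 1.3 witness `g` of `f` (binary-block variant,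
`RazBlocks.tilde`, with `R = min(r, n)` blocks of `β = 2⌈log₂ 2n⌉` bits and `K` index bits).
[cite: Raz2010, §3.3 (p. 159)] -/
def T (n : ℕ) : MvPolynomial (XZf r n) F :=
  RazBlocks.tilde n (RR r n) (ββ n) (ℓ n) (KK r n) (Kw r n) (g n)

/-- **Raz 2010, Prop. 3.6** (binary-block form): `f̃` is poly(`n`)-definable, the witness being
`g · SEL` (`RazBlocks.witness`), of p-bounded Boolean length, degree and complexity.
[cite: Raz2010, Prop. 3.6 (pp. 160–161)] -/
theorem isPolyDefinable_T (hℓ : IsPBounded ℓ) (hdeg : IsPBounded fun n => (g n).totalDegree)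
    (hL : IsPBounded fun n => complexity (g n)) :
    IsPolyDefinable (σ := XZf r) (T r ℓ g) := by
  refine ⟨fun n => ℓ n + KK r n,
    fun n => RazBlocks.witness n (RR r n) (ββ n) (ℓ n) (KK r n) (Kw r n) (g n),
    IsPBounded.add_holds hℓ (isPBounded_KK r), ?_, ?_, fun n => rfl⟩
  · refine (IsPBounded.add_holds hdeg (IsPBounded.mul_holds (isPBounded_RR r)
      (IsPBounded.add_holds isPBounded_ββ (IsPBounded.const 1)))).mono fun n => ?_
    exact RazBlocks.totalDegree_witness_le n (RR r n) (ββ n) (ℓ n) (KK r n) (Kw r n) (g n)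
  · refine (IsPBounded.add_holds (IsPBounded.add_holds hL (IsPBounded.mul_holds
      (isPBounded_RR r) (IsPBounded.add_holds (IsPBounded.mul_holds isPBounded_two_pow_ββ
        (IsPBounded.add_holds (IsPBounded.mul_holds (IsPBounded.const 3) isPBounded_ββ)
          (IsPBounded.const 2))) (IsPBounded.const 1)))) (IsPBounded.const 1)).mono fun n => ?_
    exact RazBlocks.complexity_witness_le n (RR r n) (ββ n) (ℓ n) (KK r n) (Kw r n) (g n)

/-- The number of variables of `f̃ n` is `n + R 2^β`, p-bounded. [cite: Raz2010, §3.3 (p. 159)] -/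
theorem isPBounded_card_XZf : IsPBounded fun n => Fintype.card (XZf r n) := by
  have h : (fun n => Fintype.card (XZf r n)) = fun n => n + RR r n * 2 ^ ββ n := by
    funext n
    simp [Fintype.card_sum, Fintype.card_prod, Fintype.card_fin]
  rw [h]
  exact IsPBounded.add_holds IsPBounded.id (IsPBounded.mul_holds (isPBounded_RR r)
    isPBounded_two_pow_ββ)

/-- `f̃` is a `VNP` family (Raz 2010, p. 142: poly(`n`)-definable = uniform `VNP`).
[cite: Raz2010, Prop. 3.6 (p. 160), §1.5 (p. 142)] -/
theorem isVNPFamily_T (hℓ : IsPBounded ℓ) (hdeg : IsPBounded fun n => (g n).totalDegree)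
    (hL : IsPBounded fun n => complexity (g n)) : IsVNPFamily (σ := XZf r) (T r ℓ g) :=
  (isPolyDefinable_T r ℓ g hℓ hdeg hL).isVNPFamily (isPBounded_card_XZf r)

/-- **Valiant's completeness step of the proof of Cor. 3.9**: if the permanent family over `F`
(characteristic `≠ 2`) were p-computable, the `VNP` family `f̃` would have p-bounded
complexity ("any arithmetic circuit of size `s′` for the permanent implies an arithmetic
circuit of size poly(`s′`) for any other poly(`n`)-definable polynomial", p. 163).
[cite: Raz2010, Cor. 3.9 (p. 163), proof] -/
theorem isPBounded_complexity_T (hchar : ringChar F ≠ 2)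
    (hPC : IsPComputable fun N => perPoly (Fin N) F) (hℓ : IsPBounded ℓ)
    (hdeg : IsPBounded fun n => (g n).totalDegree) (hL : IsPBounded fun n => complexity (g n)) :
    IsPBounded fun n => complexity (T r ℓ g n) := by
  have hvnp := isVNPFamily_T r ℓ g hℓ hdeg hL
  have hvnp' : IsVNPFamily fun n => renameEquiv F (Fintype.equivFin (XZf r n)) (T r ℓ g n) :=
    (isVNPFamily_renameEquiv_iff (σ := XZf r) (fun n => Fintype.equivFin (XZf r n)) _).2 hvnp
  have hproj : IsPProjection (fun n => renameEquiv F (Fintype.equivFin (XZf r n)) (T r ℓ g n))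
      (fun N => perPoly (Fin N) F) :=
    ((isVNPComplete_perPoly_holds F) hchar).2 (fun n => Fintype.card (XZf r n)) _ hvnp'
  have hcomp : IsPComputable fun n => renameEquiv F (Fintype.equivFin (XZf r n)) (T r ℓ g n) :=
    IsPComputable.of_isPProjection_holds hproj hPC
  exact IsPBounded.mono hcomp fun n => (complexity_renameEquiv_holds _ _).symm.le

/-- **Props. 3.5 and 3.3 (2) at one index, over an extension field `G`**: if `f̃ n` has
complexity `≤ s₀` (over `F`, hence over `G`, `ArithCircuit.complexity_map_le`), then for every `a ∈ Gⁿ` the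
degree-`R` form `f̃|_a` (a projection of `f̃`) is an output of the universal circuit-graph with
`N ≥ 4 s₀ (R+1)²` slots, so that each coefficient `c_idx(a)` of `f̃|_a`
(`RazBlocks.coeff_zexpZ_blockSumAt`) is the value of Raz's `(Γ_G)_{Z_idx}` at the labels.
[cite: Raz2010, Prop. 3.5 (p. 160), Prop. 3.3 (p. 158), Prop. 3.7 (p. 162)] -/
theorem key_step {G : Type u} [Field G] [Algebra F G] (n N s₀ : ℕ) (a : Fin n → G)
    (hR : 1 ≤ RR r n) (hN : 4 * s₀ * (RR r n + 1) ^ 2 ≤ N) (hK : KK r n ≤ RR r n * ββ n)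
    (hc : complexity (T r ℓ g n) ≤ s₀) :
    ∃ y : RazUniversal.Lab (σZ r n) (RR r n) N → G, ∀ (idx : ℕ), idx < 2 ^ KK r n →
      eval y (RazUniversal.uCoeff G (σZ r n) (RR r n) N
        (RazBlocks.zexpZ (RR r n) (ββ n) (KK r n) (RazDefinable.bitVec (KK r n) idx))) =
      eval a (MvPolynomial.map (algebraMap F G) (RazBlocks.cpoly n (ℓ n) (Kw r n) (g n) idx)) := by
  have hT : MvPolynomial.map (algebraMap F G) (T r ℓ g n) =
      RazBlocks.blockSum n (RR r n) (ββ n) (fun idx : Fin (2 ^ KK r n) =>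
        MvPolynomial.map (algebraMap F G) (RazBlocks.cpoly n (ℓ n) (Kw r n) (g n) idx)) := by
    unfold T
    rw [RazBlocks.tilde_eq_blockSum, RazBlocks.map_blockSum]
  have hproj : IsProjection (RazBlocks.blockSumAt n (RR r n) (ββ n)
      (fun idx : Fin (2 ^ KK r n) =>
        MvPolynomial.map (algebraMap F G) (RazBlocks.cpoly n (ℓ n) (Kw r n) (g n) idx)) a)
      (MvPolynomial.map (algebraMap F G) (T r ℓ g n)) := by
    refine ⟨Sum.elim (C ∘ a) X, fun v => ?_, ?_⟩
    · rcases v with i | z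
      · exact Or.inr ⟨a i, by simp⟩
      · exact Or.inl ⟨z, by simp⟩
    · rw [hT]
      rfl
  have hPc := (complexity_le_of_isProjection hproj).trans
    ((ArithCircuit.complexity_map_le _ _).trans hc)
  obtain ⟨y, hy⟩ := RazUniversal.exists_eval_uCoeff_eq_coeff (R := G) hR hN
    (RazBlocks.isHomogeneous_blockSumAt n (RR r n) (ββ n) _ a) hPc
  refine ⟨y, fun idx hidx => ?_⟩
  rw [hy]
  exact RazBlocks.coeff_zexpZ_blockSumAt n (RR r n) (ββ n) hK _ a ⟨idx, hidx⟩

/-- **Cor. 3.8 / Prop. 3.7 at one index** (image form): in the range `1 ≤ r ≤ n` of Cor. 3.9,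
if `f̃ n` has complexity `≤ s₀` then the polynomial mapping `f n : Gⁿ → G^m` (coordinates
`f_idx = c_idx`, `idx < m`, Def. 1.3) has its image inside the image of the degree-`(2r-1)`
mapping `Γ` of the universal circuit-graph with `N ≥ 4 s₀ (r+1)²` slots
("`Image(f) ⊂ Image(Γ_G)`", p. 162), `Γ` read on the block monomials `Z_idx` and its labels
enumerated by `Fin`. [cite: Raz2010, Prop. 3.7 (p. 162), Cor. 3.8 (p. 163)] -/
theorem range_subset_range {G : Type u} [Field G] [Algebra F G] (n N s₀ : ℕ)
    (f₀ : Fin (n * Nat.choose (n + r n - 1) (r n)) → MvPolynomial (Fin n) F)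
    (hf₀ : ∀ i : Fin (n * Nat.choose (n + r n - 1) (r n)),
      RazBlocks.cpoly n (ℓ n) (Kw r n) (g n) i = f₀ i)
    (h1 : 1 ≤ r n) (h2 : r n ≤ n) (hN : 4 * s₀ * (RR r n + 1) ^ 2 ≤ N)
    (hc : complexity (T r ℓ g n) ≤ s₀) :
    ∃ Γ : Fin (n * Nat.choose (n + r n - 1) (r n)) →
        MvPolynomial (Fin (Fintype.card (RazUniversal.Lab (σZ r n) (RR r n) N))) G,
      (∀ i, (Γ i).totalDegree ≤ 2 * r n - 1) ∧
        Set.range (polyMapEval fun i => MvPolynomial.map (algebraMap F G) (f₀ i)) ⊆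
          Set.range (polyMapEval Γ) := by
  have hR : RR r n = r n := RR_eq r h2
  have hRpos : 1 ≤ RR r n := by omega
  have hK : KK r n ≤ RR r n * ββ n := KK_le_mul r h1 h2
  have hm : n * Nat.choose (n + r n - 1) (r n) ≤ 2 ^ KK r n := m_le_two_pow_KK r h2
  refine ⟨fun idx => rename (Fintype.equivFin (RazUniversal.Lab (σZ r n) (RR r n) N))
    (RazUniversal.uCoeff G (σZ r n) (RR r n) N
      (RazBlocks.zexpZ (RR r n) (ββ n) (KK r n) (RazDefinable.bitVec (KK r n) idx))),
    fun idx => ?_, ?_⟩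
  · exact (totalDegree_rename_le _ _).trans ((RazUniversal.totalDegree_uCoeff_le _).trans
      (by omega))
  · rintro _ ⟨a, rfl⟩
    obtain ⟨y, hy⟩ := key_step r ℓ g n N s₀ a hRpos hN hK hc
    refine ⟨y ∘ (Fintype.equivFin (RazUniversal.Lab (σZ r n) (RR r n) N)).symm,
      funext fun idx => ?_⟩
    rw [polyMapEval_apply, polyMapEval_apply, eval_rename, Function.comp_assoc,
      Equiv.symm_comp_self, Function.comp_id, hy idx (lt_of_lt_of_le idx.isLt hm), hf₀ idx]

end Family

end RazCor39

/-! ### Cor. 3.9 -/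

open RazCor39 in
/-- **Raz 2010, Corollary 3.9 (= Cor. 1.6)** — discharge of the named fact `Raz2010_cor_3_9`:
over a field of characteristic `≠ 2`, a poly(`n`)-definable polynomial mapping
`f : Fⁿ → F^{n·C(n+r-1,r)}`, `1 ≤ r ≤ n ≤ s`, `s = n^{ω(1)}`, that is `(s, 2r-1)`-elusive over
some extension field for all large `n` forces the permanent family over `F` not to be
p-computable. Proof as in print (p. 163): `f̃` is a `VNP` family (Prop. 3.6, here
`RazCor39.isPolyDefinable_T`), so p-computability of `PER` and Valiant's completeness give it
p-bounded complexity (`RazCor39.isPBounded_complexity_T`); over the extension field `G`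
(`ArithCircuit.complexity_map_le`) every value `f̃|_a`, a degree-`r` form carrying `f(a)` in its
coefficients (Prop. 3.5, `RazBlocks.coeff_zexpZ_blockSumAt`), then has small circuits, hence
(Props. 2.8, 3.1–3.3, `RazUniversal.exists_eval_uCoeff_eq_coeff`) `f(a) = Γ(y)` for the
degree-`(2r-1)` polynomial mapping `Γ` of the universal circuit-graph
(`RazCor39.range_subset_range`) in polynomially many variables
(`RazCor39.isPBounded_card_lab`), fewer than `s(n)` for large `n` — contradicting
`(s, 2r-1)`-elusiveness. [cite: Raz2010, Cor. 3.9 (p. 163) = Cor. 1.6 (p. 145)] -/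
theorem Raz2010_cor_3_9_holds (F : Type u) [Field F] : Raz2010_cor_3_9 F := by
  intro hchar r s f hpar hs hdef hel hPC
  obtain ⟨ℓ, g, hℓ, hdeg, hL, hfg⟩ := hdef
  -- Prop. 3.6 + Valiant: `f̃` has p-bounded complexity.
  obtain ⟨c₁, hc₁⟩ := isPBounded_complexity_T r ℓ g hchar hPC hℓ hdeg hL
  -- The number of labels of the universal circuit-graph is eventually below `s n`.
  obtain ⟨C, n₃, hC⟩ := eventually_le_pow
    (isPBounded_card_lab r (sb := fun n => n ^ c₁ + c₁) ⟨c₁, fun n => le_rfl⟩)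
  obtain ⟨n₄, hs₄⟩ := hs C
  obtain ⟨n₁, hpar₁⟩ := hpar
  obtain ⟨n₂, hel₂⟩ := hel
  -- A large index `n`.
  obtain ⟨n, hn₁, hn₂, hn₃, hn₄⟩ : ∃ n, n₁ ≤ n ∧ n₂ ≤ n ∧ n₃ ≤ n ∧ n₄ ≤ n :=
    ⟨n₁ + n₂ + n₃ + n₄, by omega, by omega, by omega, by omega⟩
  obtain ⟨h1, h2, -⟩ := hpar₁ n hn₁
  obtain ⟨G, instG, instA, helG⟩ := hel₂ n hn₂
  -- Cor. 3.8 at this index: `Image(f) ⊆ Image(Γ)`, `deg Γ ≤ 2r - 1`, `#labels ≤ s n` variables.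
  obtain ⟨Γ, hΓ, hsub⟩ := range_subset_range (G := G) r ℓ g n (NN r (fun n => n ^ c₁ + c₁) n)
    (n ^ c₁ + c₁) (f n) (fun i => (hfg n i).symm) h1 h2 le_rfl (hc₁ n)
  exact (helG.anti_left ((hC n hn₃).trans (hs₄ n hn₄))) Γ hΓ hsub

end Literature.Computability.AlgebraicComplexity
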